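import Summits.CriticalPhenomena.PercolationContinuityZ3.Theorems.PercNearOneGluingNoHeavyPcintBSMXSiteBridge
import Summits.CriticalPhenomena.PercolationContinuityZ3.Theorems.PercNearOneGluingNoHeavyPcintOSMSiteBridge
import HarnessLib

/-!
# PCINT lane, PHASE 8 (block renewal, SITE version), step 2: the site second moment on the vertices in play

Cell `prim-pcint`, seat `prim-pcint-1` (gen 16); memo `run/shared/lean/prim/pcint/T-FIBRE-ROUTE.md` §PHASE 8.

The SITE analogue of …PcintBSMMoments.  The vertices of all `n`-block words (`BSMX.allSites`, through the injective
`BSM.ι`) index a finite product space of Boolean assignments; the weighted count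
`Z = Σ_β ν(β) x^{|V(β)|} 𝟙[V(β) open]` has `E Z = (Σ ν)^n` (`x p = 1`, `BSMX.first_momentV`) and
`E Z² = A RlocV pc ν x n 0` (`BSMX.second_momentV`, via `BSMX.card_inter_VglobS`), and the finite sum is dominated
by the site measure (`BSMX.sum_le_site_realV`, the tree's `sitePercolation_real_eq_sum`).  Cauchy–Schwarz gives
**`BSMX.le_real_blockEventV`**: `1 / A RlocV pc ν (1/p) n 0 ≤ P^site_p(some n-block word is open)` (`Σ ν = 1`), and with
`BSMX.exitEvent_of_openV`: **`BSMX.le_real_exitEventV`**,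
`1 / A RlocV pc ν (1/p) (m+2) 0 ≤ P^site_p(0 ⟷ ∂ⁱⁿB(0, m) in B(0, m))` on `ℤ^{k+t}`.
-/

noncomputable section

namespace Summit.CriticalPhenomena.PercolationContinuityZ3.Theorems.Pcint.BSMX

open Finset OSM BSM AdaptDom MeasureTheory Literature.Probability.Percolation Literature.Probability.LatticeModels

variable {t k np : ℕ}

/-! ### The sites in play -/

/-- `BSM.ι` as an embedding. -/
def ιEmb : Off t k ↪ Site (k + t) := ⟨ι, ι_injective⟩

/-- All vertices of all `n`-block words, as lattice sites. -/
def allSites (pc : Fin np → List (Fin t × Bool)) (k n : ℕ) : Finset (Site (k + t)) :=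
  (univ.biUnion fun β : Fin n → Blk np k => VglobS pc β).map ιEmb

/-- The index type of the sites in play. -/
abbrev SIdx (pc : Fin np → List (Fin t × Bool)) (k n : ℕ) := ↥(allSites pc k n)

/-- **Some `n`-block word has all its vertices open.** -/
def blockEventV (pc : Fin np → List (Fin t × Bool)) (k n : ℕ) : Set (SiteConfig (Site (k + t))) :=
  {ω | ∃ β : Fin n → Blk np k, ∀ g ∈ VglobS pc β, ι g ∈ ω}

/-- A vertex of a word is a site in play. -/
theorem ι_mem_allSites (pc : Fin np → List (Fin t × Bool)) {n : ℕ} (β : Fin n → Blk np k) {g : Off t k}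
    (hg : g ∈ VglobS pc β) : ι g ∈ allSites pc k n :=
  mem_map.2 ⟨g, mem_biUnion.2 ⟨β, mem_univ _, hg⟩, rfl⟩

/-- The event is determined by the sites in play. -/
theorem determinedBy_blockEventV (pc : Fin np → List (Fin t × Bool)) (n : ℕ) :
    DeterminedBy (blockEventV pc k n) (↑(allSites pc k n) : Set (Site (k + t))) := by
  rw [determinedBy_iff]
  intro ω ω' h
  have key : ∀ v ∈ allSites pc k n, v ∈ ω ↔ v ∈ ω' := by
    intro v hv
    constructor
    · intro hω; have : v ∈ ω ∩ ↑(allSites pc k n) := ⟨hω, hv⟩; rw [h] at this; exact this.1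
    · intro hω; have : v ∈ ω' ∩ ↑(allSites pc k n) := ⟨hω, hv⟩; rw [← h] at this; exact this.1
  simp only [blockEventV, Set.mem_setOf_eq]
  exact exists_congr fun β => forall₂_congr fun g hg => key _ (ι_mem_allSites pc β hg)

/-! ### The finite-sum bound for the site measure -/

/-- The site configuration of a Boolean assignment on the sites in play. -/
def liftV (pc : Fin np → List (Fin t × Bool)) (n : ℕ) (a : SIdx pc k n → Bool) : SiteConfig (Site (k + t)) :=
  {v | ∃ h : v ∈ allSites pc k n, a ⟨v, h⟩ = true}

/-- Membership of a site in play in the lifted configuration. -/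
theorem mem_liftV (pc : Fin np → List (Fin t × Bool)) (n : ℕ) (a : SIdx pc k n → Bool) (y : SIdx pc k n) :
    (y : Site (k + t)) ∈ liftV pc n a ↔ a y = true :=
  ⟨fun ⟨_, h⟩ => h, fun h => ⟨y.2, h⟩⟩

/-- Boolean and propositional assignments on the sites in play. -/
def boolCfgEquivV (pc : Fin np → List (Fin t × Bool)) (n : ℕ) : (SIdx pc k n → Bool) ≃ (SIdx pc k n → Prop) where
  toFun a := fun v => a v = true
  invFun y := fun v => @decide (y v) (Classical.dec _)
  left_inv a := by funext v; simp
  right_inv y := by funext v; simp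

/-- The tree's site weight of a Boolean assignment is the product weight `wt`. -/
theorem siteWeight_boolCfgEquivV (pc : Fin np → List (Fin t × Bool)) (n : ℕ) (p : unitInterval)
    (a : SIdx pc k n → Bool) : siteWeight p (boolCfgEquivV pc n a) = wt (p : ℝ) a := by
  unfold siteWeight wt bern
  refine Finset.prod_congr rfl fun v _ => ?_
  change (bernoulliProp p).real {a v = true} = if a v = true then (p : ℝ) else 1 - p
  cases hv : a v
  · simp
  · simp

open Classical in
/-- **`P^site_p` dominates the finite sum over Boolean assignments on the sites in play.** -/
theorem sum_le_site_realV (pc : Fin np → List (Fin t × Bool)) (n : ℕ) (p : unitInterval)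
    {E : Set (SiteConfig (Site (k + t)))} (hE : DeterminedBy E (↑(allSites pc k n) : Set (Site (k + t)))) :
    ∑ a : SIdx pc k n → Bool, wt (p : ℝ) a * (if liftV pc n a ∈ E then (1 : ℝ) else 0) ≤
      (sitePercolation (Site (k + t)) p).real E := by
  rw [sitePercolation_real_eq_sum p hE]
  have hiff : ∀ a : SIdx pc k n → Bool, boolCfgEquivV pc n a ∈ traceEvent (allSites pc k n) E ↔ liftV pc n a ∈ E := by
    intro a
    unfold traceEvent liftSiteConfig liftV boolCfgEquivV
    exact Iff.rfl
  have step1 : ∑ a : SIdx pc k n → Bool, wt (p : ℝ) a * (if liftV pc n a ∈ E then (1 : ℝ) else 0) =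
      ∑ a ∈ univ.filter (fun a : SIdx pc k n → Bool => liftV pc n a ∈ E), wt (p : ℝ) a := by
    rw [Finset.sum_filter]
    refine Finset.sum_congr rfl fun a _ => ?_
    split_ifs <;> simp
  have step2 : ∑ a ∈ univ.filter (fun a : SIdx pc k n → Bool => liftV pc n a ∈ E), wt (p : ℝ) a =
      ∑ y ∈ (univ.filter (fun a : SIdx pc k n → Bool => liftV pc n a ∈ E)).map (boolCfgEquivV pc n).toEmbedding,
        siteWeight p y := by
    rw [Finset.sum_map]
    exact Finset.sum_congr rfl fun a _ => by rw [Equiv.coe_toEmbedding, siteWeight_boolCfgEquivV]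
  rw [step1, step2]
  refine Finset.sum_le_sum_of_subset_of_nonneg ?_ fun y _ _ => siteWeight_nonneg p y
  intro y hy
  rw [Finset.mem_map] at hy
  obtain ⟨a, ha, rfl⟩ := hy
  exact mem_filter.2 ⟨by simp, (hiff a).2 (mem_filter.1 ha).2⟩

/-! ### Open words and the two moments -/

/-- The vertices of `β` as indices in play. -/
def VY (pc : Fin np → List (Fin t × Bool)) (n : ℕ) (β : Fin n → Blk np k) : Finset (SIdx pc k n) :=
  univ.filter fun y => (y : Site (k + t)) ∈ (VglobS pc β).map ιEmb

/-- `VY β` has as many elements as `VglobS β`. -/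
theorem card_VY (pc : Fin np → List (Fin t × Bool)) (n : ℕ) (β : Fin n → Blk np k) :
    (VY (k := k) pc n β).card = (VglobS pc β).card := by
  rw [← card_map ιEmb]
  refine Finset.card_bij (fun y _ => y.1) (fun y hy => (mem_filter.1 hy).2) (fun y _ y' _ h => Subtype.ext h)
    (fun v hv => ?_)
  obtain ⟨g, hg, rfl⟩ := mem_map.1 hv
  exact ⟨⟨ι g, mem_map.2 ⟨g, mem_biUnion.2 ⟨β, mem_univ _, hg⟩, rfl⟩⟩, mem_filter.2 ⟨mem_univ _, hv⟩, rfl⟩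

/-- Shared indices are shared vertex keys. -/
theorem card_VY_inter (pc : Fin np → List (Fin t × Bool)) (n : ℕ) (β β' : Fin n → Blk np k) :
    (VY (k := k) pc n β ∩ VY pc n β').card = (VglobS pc β ∩ VglobS pc β').card := by
  rw [← card_map ιEmb, map_inter]
  refine Finset.card_bij (fun y _ => y.1) (fun y hy => ?_) (fun y _ y' _ h => Subtype.ext h) (fun v hv => ?_)
  · rw [mem_inter] at hy ⊢; exact ⟨(mem_filter.1 hy.1).2, (mem_filter.1 hy.2).2⟩
  · rw [mem_inter] at hv
    obtain ⟨g, hg, rfl⟩ := mem_map.1 hv.1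
    exact ⟨⟨ι g, mem_map.2 ⟨g, mem_biUnion.2 ⟨β, mem_univ _, hg⟩, rfl⟩⟩,
      mem_inter.2 ⟨mem_filter.2 ⟨mem_univ _, hv.1⟩, mem_filter.2 ⟨mem_univ _, hv.2⟩⟩, rfl⟩

/-- The lifted configuration lies in the event iff some word has all its vertices set. -/
theorem liftV_mem_iff (pc : Fin np → List (Fin t × Bool)) (n : ℕ) (a : SIdx pc k n → Bool) :
    liftV pc n a ∈ blockEventV pc k n ↔ ∃ β, ∀ y ∈ VY pc n β, a y = true := by
  simp only [blockEventV, Set.mem_setOf_eq]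
  refine exists_congr fun β => ?_
  constructor
  · intro h y hy
    obtain ⟨g, hg, hgy⟩ := mem_map.1 (mem_filter.1 hy).2
    have := h g hg
    rw [show ι g = (y : Site (k + t)) from hgy] at this
    exact (mem_liftV pc n a y).1 this
  · intro h g hg
    have hy : (⟨ι g, ι_mem_allSites pc β hg⟩ : SIdx pc k n) ∈ VY pc n β :=
      mem_filter.2 ⟨mem_univ _, mem_map.2 ⟨g, hg, rfl⟩⟩
    exact (mem_liftV pc n a _).2 (h _ hy)

/-- **The weighted number of open words** `Z = Σ_β ν(β) x^{|V(β)|} 𝟙[β open]`. -/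
def ZV (pc : Fin np → List (Fin t × Bool)) (n : ℕ) (ν : Blk np k → ℝ) (x : ℝ) (a : SIdx pc k n → Bool) : ℝ :=
  ∑ β : Fin n → Blk np k, wt' ν β * x ^ (VY pc n β).card * (if ∀ y ∈ VY pc n β, a y = true then 1 else 0)

/-- `Z = 0` unless some word is open. -/
theorem ZV_eq_zero (pc : Fin np → List (Fin t × Bool)) (n : ℕ) (ν : Blk np k → ℝ) (x : ℝ)
    {a : SIdx pc k n → Bool} (h : ¬ ∃ β, ∀ y ∈ VY pc n β, a y = true) : ZV pc n ν x a = 0 :=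
  sum_eq_zero fun β _ => by rw [if_neg (not_exists.1 h β), mul_zero]

/-- The weight of "all bits of `S ∪ S'` set". -/
theorem sum_wt_open_pairV (pc : Fin np → List (Fin t × Bool)) (n : ℕ) (p : ℝ) (β β' : Fin n → Blk np k) :
    ∑ a : SIdx pc k n → Bool, wt p a * ((if ∀ y ∈ VY pc n β, a y = true then (1 : ℝ) else 0) *
        (if ∀ y ∈ VY pc n β', a y = true then (1 : ℝ) else 0)) = p ^ (VY pc n β ∪ VY pc n β').card := by
  have : ∀ a : SIdx pc k n → Bool, (if ∀ y ∈ VY pc n β, a y = true then (1 : ℝ) else 0) *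
      (if ∀ y ∈ VY pc n β', a y = true then (1 : ℝ) else 0) =
        if ∀ y ∈ VY pc n β ∪ VY pc n β', a y = true then (1 : ℝ) else 0 := by
    intro a
    by_cases h1 : ∀ y ∈ VY pc n β, a y = true
    · by_cases h2 : ∀ y ∈ VY pc n β', a y = true
      · rw [if_pos h1, if_pos h2, if_pos (fun y hy => (mem_union.1 hy).elim (h1 y) (h2 y)), one_mul]
      · rw [if_neg h2, mul_zero, if_neg (fun h => h2 fun y hy => h y (mem_union_right _ hy))]
    · rw [if_neg h1, zero_mul, if_neg (fun h => h1 fun y hy => h y (mem_union_left _ hy))]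
  simp_rw [this]
  exact sum_wt_all' p (VY pc n β ∪ VY pc n β')

/-- **First moment**: `Σ_a π_p(a) Z(a) = (Σ ν)^n` when `x p = 1`. -/
theorem first_momentV (pc : Fin np → List (Fin t × Bool)) (n : ℕ) (ν : Blk np k → ℝ) {x p : ℝ} (hxp : x * p = 1) :
    ∑ a : SIdx pc k n → Bool, wt p a * ZV pc n ν x a = (∑ b : Blk np k, ν b) ^ n := by
  unfold ZV
  simp_rw [mul_sum]
  rw [sum_comm, ← sum_wt']
  refine sum_congr rfl fun β _ => ?_
  calc ∑ a : SIdx pc k n → Bool, wt p a * (wt' ν β * x ^ (VY pc n β).card *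
        (if ∀ y ∈ VY pc n β, a y = true then (1 : ℝ) else 0))
      = wt' ν β * x ^ (VY pc n β).card *
        ∑ a : SIdx pc k n → Bool, wt p a * (if ∀ y ∈ VY pc n β, a y = true then (1 : ℝ) else 0) := by
        rw [mul_sum]; exact sum_congr rfl fun a _ => by ring
    _ = wt' ν β := by
        rw [sum_wt_all' p (VY pc n β), mul_assoc, ← mul_pow, hxp, one_pow, mul_one]

/-- **Second moment**: `Σ_a π_p(a) Z(a)² = A RlocV pc ν x n 0` when `x p = 1`. -/
theorem second_momentV (pc : Fin np → List (Fin t × Bool)) (n : ℕ) (ν : Blk np k → ℝ) {x p : ℝ} (hxp : x * p = 1) :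
    ∑ a : SIdx pc k n → Bool, wt p a * ZV pc n ν x a ^ 2 = A (RlocV pc) pc ν x n 0 := by
  have hsq : ∀ a : SIdx pc k n → Bool, wt p a * ZV pc n ν x a ^ 2 =
      ∑ β : Fin n → Blk np k, ∑ β' : Fin n → Blk np k, (wt' ν β * wt' ν β' *
        x ^ ((VY pc n β).card + (VY pc n β').card)) * (wt p a *
          ((if ∀ y ∈ VY pc n β, a y = true then (1 : ℝ) else 0) *
            (if ∀ y ∈ VY pc n β', a y = true then (1 : ℝ) else 0))) := by
    intro a
    rw [ZV, sq, sum_mul_sum, mul_sum]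
    refine sum_congr rfl fun β _ => ?_
    rw [mul_sum]
    refine sum_congr rfl fun β' _ => ?_
    rw [pow_add]; ring
  simp_rw [hsq]
  rw [sum_comm, A]
  refine sum_congr rfl fun β _ => ?_
  rw [sum_comm]
  refine sum_congr rfl fun β' _ => ?_
  rw [← mul_sum, sum_wt_open_pairV, ← card_inter_VglobS, ← card_VY_inter pc n]
  have hcard : (VY (k := k) pc n β ∪ VY pc n β').card + (VY pc n β ∩ VY pc n β').card =
      (VY pc n β).card + (VY pc n β').card := card_union_add_card_inter _ _
  have key : x ^ ((VY (k := k) pc n β).card + (VY pc n β').card) * p ^ (VY (k := k) pc n β ∪ VY pc n β').card =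
      x ^ (VY (k := k) pc n β ∩ VY pc n β').card := by
    rw [← hcard, pow_add, mul_assoc, mul_comm (x ^ _) (p ^ _), ← mul_assoc, ← mul_pow, hxp, one_pow, one_mul]
  rw [mul_assoc, key]

open Classical in
/-- **The site second-moment bound**: if `Σ ν = 1` then `P^site_p(blockEventV) ≥ 1 / A RlocV pc ν (1/p) n 0`. -/
theorem le_real_blockEventV (pc : Fin np → List (Fin t × Bool)) (n : ℕ) {ν : Blk np k → ℝ} (hν : ∀ b, 0 ≤ ν b)
    (hν1 : ∑ b : Blk np k, ν b = 1) (p : unitInterval) (hp : 0 < (p : ℝ)) :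
    1 / A (RlocV pc) pc ν (1 / p) n 0 ≤ (sitePercolation (Site (k + t)) p).real (blockEventV pc k n) := by
  set I : (SIdx pc k n → Bool) → ℝ := fun a => if ∃ β, ∀ y ∈ VY pc n β, a y = true then 1 else 0 with hI
  have hreal : ∑ a : SIdx pc k n → Bool, wt (p : ℝ) a * I a ≤
      (sitePercolation (Site (k + t)) p).real (blockEventV pc k n) := by
    refine le_trans (le_of_eq (sum_congr rfl fun a _ => ?_)) (sum_le_site_realV pc n p (determinedBy_blockEventV pc n))
    rw [hI]; dsimp only
    exact congr_arg _ (if_congr (liftV_mem_iff pc n a).symm rfl rfl)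
  refine le_trans ?_ hreal
  have hxp : 1 / (p : ℝ) * p = 1 := by field_simp
  have hw : ∀ a : SIdx pc k n → Bool, 0 ≤ wt (p : ℝ) a := wt_nonneg p.2.1 p.2.2
  -- Cauchy–Schwarz `(Σ π Z)² ≤ (Σ π Z²)(Σ π I)`
  have hcs := sum_sq_le_sum_mul_sum_of_sq_le_mul (univ : Finset (SIdx pc k n → Bool))
    (r := fun a => wt (p : ℝ) a * ZV pc n ν (1 / p) a) (f := fun a => wt (p : ℝ) a * ZV pc n ν (1 / p) a ^ 2)
    (g := fun a => wt (p : ℝ) a * I a) (fun a _ => mul_nonneg (hw a) (sq_nonneg _))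
    (fun a _ => mul_nonneg (hw a) (by rw [hI]; dsimp only; split_ifs <;> norm_num)) (fun a _ => by
      by_cases h : ∃ β, ∀ y ∈ VY pc n β, a y = true
      · rw [hI]; dsimp only; rw [if_pos h]; exact le_of_eq (by ring)
      · rw [ZV_eq_zero pc n ν (1 / p) h]; simp)
  rw [first_momentV (k := k) pc n ν hxp, second_momentV (k := k) pc n ν hxp, hν1, one_pow] at hcs
  have hA : 0 < A (RlocV pc) pc ν (1 / p) n 0 := by
    rcases (A_nonneg (RlocV pc) pc hν (by positivity : (0 : ℝ) ≤ 1 / p) n 0).eq_or_lt with h | h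
    · rw [← h, zero_mul] at hcs; norm_num at hcs
    · exact h
  rw [div_le_iff₀ hA, mul_comm]
  simpa using hcs

/-- **The bridge (sites)**: `1 / A RlocV pc ν (1/p) (m+2) 0 ≤ P^site_p(0 ⟷ ∂ⁱⁿB(0, m) in B(0, m))` on `ℤ^{k+t}`. -/
theorem le_real_exitEventV (pc : Fin np → List (Fin t × Bool)) {ν : Blk np k → ℝ} (hν : ∀ b, 0 ≤ ν b)
    (hν1 : ∑ b : Blk np k, ν b = 1) (p : unitInterval) (hp : 0 < (p : ℝ)) (m : ℕ) :
    1 / A (RlocV pc) pc ν (1 / p) (m + 2) 0 ≤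
      (sitePercolation (Site (k + t)) p).real
        (exitEvent (zdGraph (k + t)) (DCTQ.ball (zdGraph (k + t)) (0 : Site (k + t)) m) (0 : Site (k + t))) :=
  (le_real_blockEventV pc (m + 2) hν hν1 p hp).trans
    (measureReal_mono (fun _ hE => by obtain ⟨β, hβ⟩ := hE; exact exitEvent_of_openV pc β hβ) (measure_ne_top _ _))

end Summit.CriticalPhenomena.PercolationContinuityZ3.Theorems.Pcint.BSMX

end
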